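import Summits.MatrixMultiplication.OmegaCensus.STPPSmallPatternT1K12OrderLaw96

/-!
# ω-census, small pattern `(2,1,1)¹²`: the `T1` order law LOWERED to `95` — every finite abelian group of order `≥ 95` hosts `(2,1,1)¹²`

Cell `pub-omega`, ω construction census, seat pub-omega ENG2 (gen 39), 2026-08-30.  HONEST FRAMING (verbatim): lottery ticket; floor = certified
bounds/negative ranges.  Census STRUCTURE bookkeeping (row B5 / conjecture C10 column `T1` at `k = 12`); nothing here bears on `ω`.

The law of record `exists_isSTPP_211pow12_of_card_ge_96` (`STPPSmallPatternT1K12OrderLaw96`) covers every finite abelian group of order `≥ 96`.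
Night 34's reserve job (kit GO #176 j337414 'eng2-capwalk3-arm3', engine γ) found `(2,1,1)¹² ⊆ ℤ/95` (`exists_isSTPP_211pow12_zmod95`,
`STPPSmallPatternT1K12LowHosts` Appendix 1).  Since `95 = 5 · 19` is squarefree, `ℤ/95` is the only abelian group of order `95`; formally, by Cauchy a
group of order `95` has elements of order `5` and `19`, whose sum has order `95`, and `exists_isSTPP_211pow12_of_addOrderOf_ge95` applies.  Hence the
law drops to `95` with no new search.  `ℤ/94` is open (blank at the job's budget, no claim), so `95` is NOT claimed sharp.
References: H. Cohn, R. Kleinberg, B. Szegedy, C. Umans, FOCS 2005 (arXiv:math/0511460), Def. 5.1.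
-/

open Literature.Computability.AlgebraicComplexity Finset

namespace Summit.MatrixMultiplication.OmegaCensus

/-- A finite additive commutative group of order exactly `95` has an element of additive order `95` (Cauchy at `5` and `19`, then the order of a sum of
commuting elements of coprime orders). [folklore] -/
theorem exists_addOrderOf_eq_95_of_card_eq_95 {G : Type*} [AddCommGroup G] [Finite G] (hG : Nat.card G = 95) :
    ∃ g : G, addOrderOf g = 95 := by
  haveI : Fact (Nat.Prime 5) := ⟨by norm_num⟩
  haveI : Fact (Nat.Prime 19) := ⟨by norm_num⟩
  obtain ⟨a, ha⟩ := exists_prime_addOrderOf_dvd_card' (G := G) 5 (by rw [hG]; norm_num)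
  obtain ⟨b, hb⟩ := exists_prime_addOrderOf_dvd_card' (G := G) 19 (by rw [hG]; norm_num)
  refine ⟨a + b, ?_⟩
  rw [(AddCommute.all a b).addOrderOf_add_eq_mul_addOrderOf_of_coprime (by rw [ha, hb]; norm_num), ha, hb]

/-- **THE `k = 12` LAW AT `95`: every finite abelian group of order `≥ 95` admits an STPP family of size pattern `(2,1,1)¹²`** (CKSU Def. 5.1,
tree `IsSTPP`).  Order `≥ 96`: the law of record; order `= 95`: an element of order `95` and the transport lemma
`exists_isSTPP_211pow12_of_addOrderOf_ge95` (kit GO #176's `ℤ/95` witness).  No `ω` bound follows; `95` is not claimed sharp (`ℤ/94` open).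
[cite: CohnKleinbergSzegedyUmans2005, Def. 5.1] -/
theorem exists_isSTPP_211pow12_of_card_ge_95 {G : Type*} [AddCommGroup G] [Finite G] (hG : 95 ≤ Nat.card G) :
    ∃ A B C : Fin 12 → Finset G, IsSTPP A B C ∧ ∀ i, (A i).card = 2 ∧ (B i).card = 1 ∧ (C i).card = 1 := by
  by_cases h : 96 ≤ Nat.card G
  · exact exists_isSTPP_211pow12_of_card_ge_96 h
  · obtain ⟨g, hg⟩ := exists_addOrderOf_eq_95_of_card_eq_95 (G := G) (by omega)
    exact exists_isSTPP_211pow12_of_addOrderOf_ge95 g (by omega)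

/-- `Nat.card`-monotone form for the census tables: `95 ≤ n ≤ Nat.card G` ⇒ host. [cite: CohnKleinbergSzegedyUmans2005, Def. 5.1] -/
theorem exists_isSTPP_211pow12_of_le_card95 {G : Type*} [AddCommGroup G] [Finite G] {n : ℕ} (hn : 95 ≤ n) (hG : n ≤ Nat.card G) :
    ∃ A B C : Fin 12 → Finset G, IsSTPP A B C ∧ ∀ i, (A i).card = 2 ∧ (B i).card = 1 ∧ (C i).card = 1 :=
  exists_isSTPP_211pow12_of_card_ge_95 (le_trans hn hG)

end Summit.MatrixMultiplication.OmegaCensus
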